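import Mathlib.Analysis.SpecialFunctions.SmoothTransition
import Mathlib.Analysis.Complex.ExponentialBounds
import HarnessLib

/-!
# The dissipation-scale weight profile `Ψ(x) = (1 − x)·S(10(1 − x))`: a smooth cut-off in the two-weight corridor

Analysis/Fourier support file (ONE definition + proofs; no named facts).  The fixed smooth profile used as the low-mode
weight `ω_k = Ψ(r_k τ)` of the two-weight Lyapunov functional for advection–diffusion
(`FluidPDE.PassiveVectorTensorWeightedDecay.ae_twoWeight_decay` takes a weight with `0 ≤ ω ≤ 1` and the CORRIDOR
condition `log 2·(1 − ω_k) ≤ (4/5)·x_k`; its conclusion is the dissipation floor iff moreover `ω_k ≤ (1 − x_k)₊`):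

  `Real.dissipProfile x = (1 − x) · Real.smoothTransition (10 (1 − x))`

— equal to `1 − x` on `x ≤ 9/10`, in `[0, 1 − x]` on `[9/10, 1]`, `0` on `x ≥ 1`, smooth (`C^∞`):
* `dissipProfile_eq_of_le` / `dissipProfile_eq_zero_of_le` — the two explicit regimes;
* `dissipProfile_nonneg`, `dissipProfile_le_one_sub`, `dissipProfile_le_one`, `dissipProfile_zero` — `0 ≤ Ψ ≤ (1−x)₊ ≤ 1` on
  `x ≥ 0`, `Ψ(0) = 1`;
* `log_two_mul_one_sub_dissipProfile_le` — the corridor's lower edge `log 2·(1 − Ψ x) ≤ (4/5)·x` for `x ≥ 0`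
  (`log 2 < 0.6932`);
* `contDiff_dissipProfile` — smoothness (products/compositions of `Real.smoothTransition`).
Design note: the corridor has relative width `(4/5)/log 2 − 1 ≈ 0.154`; any smooth profile inside it works, this one keeps
`1 − Ψ = x` exactly below `9/10` so that the two inequalities are one-liners.

Consumer: cell `ad-ideate`, K1L_D `stmt-AnomalousDissipation-27980`, W3-E (i) (re-plan P2d/P4; crux memo
`Lines/onelevel-W3E-k3l-lyapunov.md`).

## Mathlib / tree search
Mathlib: `Real.smoothTransition` (`zero_of_nonpos`, `one_of_one_le`, `nonneg`, `le_one`, `contDiff`), `Real.log_two_lt_d9`.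
No bump profile with these normalisations in the tree (`rg smoothTransition Literature/`: unrelated cut-offs).

## References
* J. Bedrossian, M. Coti Zelati, Arch. Ration. Mech. Anal. 224 (2017), §2 (energy functionals with frequency cut-offs). [`BedrossianCotiZelati2017`]
-/

noncomputable section

namespace Real

/-- **The dissipation-scale weight profile** `Ψ(x) = (1 − x)·S(10(1 − x))`, `S = Real.smoothTransition`: smooth,
`= 1 − x` for `x ≤ 9/10`, `= 0` for `x ≥ 1`. [cite: BedrossianCotiZelati2017, §2] -/
def dissipProfile (x : ℝ) : ℝ := (1 - x) * Real.smoothTransition (10 * (1 - x))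

/-- Below `9/10` the profile is `1 − x`. [cite: BedrossianCotiZelati2017, §2] -/
theorem dissipProfile_eq_of_le {x : ℝ} (hx : x ≤ 9 / 10) : dissipProfile x = 1 - x := by
  unfold dissipProfile
  rw [Real.smoothTransition.one_of_one_le (by linarith), mul_one]

/-- Above `1` the profile vanishes. [cite: BedrossianCotiZelati2017, §2] -/
theorem dissipProfile_eq_zero_of_le {x : ℝ} (hx : 1 ≤ x) : dissipProfile x = 0 := by
  unfold dissipProfile
  rw [Real.smoothTransition.zero_of_nonpos (by linarith), mul_zero]

/-- `Ψ(0) = 1`. [cite: BedrossianCotiZelati2017, §2] -/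
@[simp] theorem dissipProfile_zero : dissipProfile 0 = 1 := by
  rw [dissipProfile_eq_of_le (by norm_num)]; norm_num

/-- `Ψ x ≤ 1 − x` for `x ≤ 1`, and `Ψ x ≤ max 0 (1 − x)` always. [cite: BedrossianCotiZelati2017, §2] -/
theorem dissipProfile_le_max (x : ℝ) : dissipProfile x ≤ max 0 (1 - x) := by
  rcases le_or_gt 1 x with h | h
  · rw [dissipProfile_eq_zero_of_le h]; exact le_max_left _ _
  · refine le_trans ?_ (le_max_right _ _)
    unfold dissipProfile
    exact mul_le_of_le_one_right (by linarith) (Real.smoothTransition.le_one _)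

/-- `0 ≤ Ψ x`. [cite: BedrossianCotiZelati2017, §2] -/
theorem dissipProfile_nonneg (x : ℝ) : 0 ≤ dissipProfile x := by
  rcases le_or_gt 1 x with h | h
  · rw [dissipProfile_eq_zero_of_le h]
  · unfold dissipProfile
    exact mul_nonneg (by linarith) (Real.smoothTransition.nonneg _)

/-- `Ψ x ≤ 1` for `0 ≤ x`. [cite: BedrossianCotiZelati2017, §2] -/
theorem dissipProfile_le_one {x : ℝ} (hx : 0 ≤ x) : dissipProfile x ≤ 1 :=
  (dissipProfile_le_max x).trans (max_le zero_le_one (by linarith))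

/-- **The corridor's lower edge**: `log 2 · (1 − Ψ x) ≤ (4/5)·x` for `x ≥ 0` (`1 − Ψ = x` below `9/10`, `log 2 < 0.72 ≤ (4/5)x`
above). [cite: BedrossianCotiZelati2017, §2] -/
theorem log_two_mul_one_sub_dissipProfile_le {x : ℝ} (hx : 0 ≤ x) :
    Real.log 2 * (1 - dissipProfile x) ≤ 4 / 5 * x := by
  have hlog : Real.log 2 < 0.6931471808 := Real.log_two_lt_d9
  have hlog0 : 0 < Real.log 2 := Real.log_pos (by norm_num)
  rcases le_or_gt x (9 / 10) with h | h
  · rw [dissipProfile_eq_of_le h]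
    nlinarith
  · have h1 : 1 - dissipProfile x ≤ 1 := by linarith [dissipProfile_nonneg x]
    calc Real.log 2 * (1 - dissipProfile x) ≤ Real.log 2 * 1 := mul_le_mul_of_nonneg_left h1 hlog0.le
      _ ≤ 4 / 5 * x := by linarith

/-- **Smoothness**: `Ψ` is `C^∞`. [cite: BedrossianCotiZelati2017, §2] -/
theorem contDiff_dissipProfile {n : ℕ∞} : ContDiff ℝ n dissipProfile := by
  unfold dissipProfile
  exact (contDiff_const.sub contDiff_id).mul
    (Real.smoothTransition.contDiff.comp (contDiff_const.mul (contDiff_const.sub contDiff_id)))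

end Real

end
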